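import Literature.IUT.LogVolume.DHProbabilisticSzpiro
import Mathlib.Analysis.MeanInequalities
import Mathlib.Analysis.SpecialFunctions.Pow.Real
import Mathlib.Analysis.SpecialFunctions.Log.Base
import Mathlib.Analysis.Complex.ExponentialBounds
import HarnessLib

/-!
# Dupuy–Hilado (arXiv:2004.13108v2) §7.1–§7.8: the bookkeeping behind Probabilistic Szpiro, PROVED —
# linearity / marginals / independence of `E²_p`, Jensen (7.1), Lemma 7.7.1 (2), (7.8), (7.10)–(7.11)

PROOF-ONLY companion of `DHProbabilisticSzpiro` (same namespace; nothing there is restated or edited): the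
candidate statements `SectionRamification.Lemma771ii`, `BoundII`, `BoundIII` typed there from T. Dupuy,
A. Hilado, *Probabilistic Szpiro, Baby Szpiro, and Explicit Szpiro from Mochizuki's Corollary 3.12*,
arXiv:2004.13108v2 [DupuyHilado2020] (held render `book:anonnd-2004-13108v2`, locators `p.N l.M`) are
DISCHARGED here as theorems for every prime `p` — they are the paper's own unconditional averaging steps and
do not involve [IUTchIII] Cor. 3.12:

* §7.3 p.23 l.1–8 ("pull-back from a projection", "`E(g(X_1)⋯g(X_n)) = E(g(X))^n`"): `sum_tuple_coord`,
  `sum_tuple_sum_coord`, `sum_tuple_prod` over the tuple spaces `V(F₀)_p^{j+1}` of [DupuyHilado2025] §3.6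
  (`tupleWeights`, cited by name), and the linearity of `E²_p` (`E2_add`, `E2_const_mul`, `E2_neg`, `E2_of_j`);
* §7.2 (7.1) p.22 l.54–61 (Jensen for `exp`/`ln`): `jensen_logb`, `jensen_log`, from Mathlib's weighted
  AM–GM inequality `Real.geom_mean_le_arith_mean_weighted`;
* **Lemma 7.7.1 (2)** p.25 l.20, l.47–51: `lemma771ii_holds`; **(7.8)** p.25 l.4–6 with its proof p.25 l.54 –
  p.26 l.16: `boundII_holds`;
* **(7.10)–(7.11)** p.26 l.17–45: "`E(1_ram(v_0,…,v_j)) = 1 − P_{unr,p}^{j+1}`" (`sum_tuple_indRam`), the exact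
  value `III_p = 1 − (2/(l−1)) Σ_j P_{unr,p}^{j+1}` (`termIII_eq`) and `boundIII_holds`;
* constants: `ln(b_p) < 0` for every prime (`log_bConst_neg`; `b_p = 1/(exp(1) ln p)`, p.3 l.35), `0 ≤ P_{unr,p} ≤ 1`.

The sequels `DHProbabilisticSzpiroTermIV` ((7.12), (7.14), (7.5)) and `DHProbabilisticSzpiroCorrected`
((7.6), (7.15)) continue the chain. HONEST FRAMING: these are elementary identities and inequalities about
finite weighted averages; nothing here asserts, uses or bears on the disputed [IUTchIII] Cor. 3.12
[claim: Mochizuki2012, status: disputed] or on Claim 5.0.1 — those enter the paper only through (7.3)/(7.4),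
which stay typed hypotheses (`TautologicalProbabilisticIneq`, `Ineq74`). Typed ≠ proved ≠ endorsed; no side
is taken on any author.
-/

noncomputable section

namespace Literature.IUT.LogVolume

open NumberField IsDedekindDomain Finset

namespace ExplicitSzpiro

variable {F₀ : Type*} [Field F₀] [NumberField F₀] (X : PilotData F₀) (R : SectionRamification F₀)

/-! ## §0 Bookkeeping: linearity of `E²_p`, marginals and independence over tuples -/

/-- `E²_p` is additive in the integrand. [cite: DupuyHilado2020, §7.1 p.22 l.44–53] -/
theorem E2_add (p lstar : ℕ) (f g : (j : ℕ) → (Fin (j + 1) → placesOver F₀ p) → ℝ) :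
    E2 p lstar (fun j e => f j e + g j e) = E2 p lstar f + E2 p lstar g := by
  unfold E2
  rw [← mul_add, ← Finset.sum_add_distrib]
  congr 1
  refine Finset.sum_congr rfl fun i _ => ?_
  rw [← Finset.sum_add_distrib]
  refine Finset.sum_congr rfl fun e _ => ?_
  ring

/-- `E²_p` is homogeneous in the integrand. [cite: DupuyHilado2020, §7.1 p.22 l.44–53] -/
theorem E2_const_mul (p lstar : ℕ) (c : ℝ) (f : (j : ℕ) → (Fin (j + 1) → placesOver F₀ p) → ℝ) :
    E2 p lstar (fun j e => c * f j e) = c * E2 p lstar f := by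
  have h : ∀ i : Fin lstar,
      ∑ e : Fin ((i : ℕ) + 1 + 1) → placesOver F₀ p, c * f ((i : ℕ) + 1) e * ∏ k, weight F₀ (e k).1 =
        c * ∑ e : Fin ((i : ℕ) + 1 + 1) → placesOver F₀ p, f ((i : ℕ) + 1) e * ∏ k, weight F₀ (e k).1 := by
    intro i
    rw [Finset.mul_sum]
    refine Finset.sum_congr rfl fun e _ => ?_
    ring
  unfold E2
  rw [Finset.sum_congr rfl fun i _ => h i, ← Finset.mul_sum]
  ring

/-- `E²_p` of a negated integrand. [cite: DupuyHilado2020, §7.1 p.22 l.44–53] -/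
theorem E2_neg (p lstar : ℕ) (f : (j : ℕ) → (Fin (j + 1) → placesOver F₀ p) → ℝ) :
    E2 p lstar (fun j e => -f j e) = -E2 p lstar f := by
  have : (fun j e => -f j e) = (fun j e => (-1 : ℝ) * f j e) := by
    funext j e; ring
  rw [this, E2_const_mul]
  ring

/-- Total mass one of the tuple weights (prime `p`). [cite: DupuyHilado2025, §3.6] -/
theorem sum_tuple_weight (p : ℕ) [Fact p.Prime] (n : ℕ) :
    ∑ e : Fin (n + 1) → placesOver F₀ p, ∏ k, weight F₀ (e k).1 = 1 :=
  (tupleWeights F₀ p n).sum_pr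

/-- Total mass one of the place weights (prime `p`), Finset form. [cite: DupuyHilado2025, §3.6] -/
theorem sum_weight (p : ℕ) [Fact p.Prime] : ∑ v ∈ placesOver F₀ p, weight F₀ v = 1 := by
  have := (localWeights F₀ p).sum_pr
  rwa [localWeights, Finset.sum_coe_sort (placesOver F₀ p) (weight F₀)] at this

/-- Coordinate marginal (§7.3 p.23 l.1–6: "`E(f(X_1,…,X_n)) = E(g(X))`" when `f` depends on one coordinate
only): a tuple-average of a function of one coordinate is the place-average. [cite: DupuyHilado2020, §7.3 p.23 l.1–6] -/
theorem sum_tuple_coord (p : ℕ) [Fact p.Prime] (j : ℕ) (i : Fin (j + 1)) (h : placesOver F₀ p → ℝ) :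
    ∑ e : Fin (j + 1) → placesOver F₀ p, h (e i) * ∏ k, weight F₀ (e k).1 =
      ∑ v : placesOver F₀ p, h v * weight F₀ v.1 :=
  tupleWeights_expect_coord F₀ p j i h

/-- Coordinate marginal, Finset form. [cite: DupuyHilado2020, §7.3 p.23 l.1–6] -/
theorem sum_tuple_coord' (p : ℕ) [Fact p.Prime] (j : ℕ) (i : Fin (j + 1))
    (g : HeightOneSpectrum (𝓞 F₀) → ℝ) :
    ∑ e : Fin (j + 1) → placesOver F₀ p, g (e i).1 * ∏ k, weight F₀ (e k).1 =
      ∑ v ∈ placesOver F₀ p, g v * weight F₀ v := by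
  rw [sum_tuple_coord p j i (fun v => g v.1),
    Finset.sum_coe_sort (placesOver F₀ p) (fun v => g v * weight F₀ v)]

/-- Independence (§7.3 p.23 l.7–8: "`E(g(X_1)g(X_2)⋯g(X_n)) = E(g(X))^n`"): the tuple-average of a product
over the coordinates is the power of the place-average. [cite: DupuyHilado2020, §7.3 p.23 l.7–8] -/
theorem sum_tuple_prod (p : ℕ) (n : ℕ) (g : placesOver F₀ p → ℝ) :
    ∑ e : Fin n → placesOver F₀ p, (∏ k, g (e k)) * ∏ k, weight F₀ (e k).1 =
      (∑ v : placesOver F₀ p, g v * weight F₀ v.1) ^ n := by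
  rw [Fintype.sum_pow]
  refine Finset.sum_congr rfl fun e _ => ?_
  rw [← Finset.prod_mul_distrib]

/-- `E²_p` of a quantity depending on `j` only is its uniform average over `j` (prime `p`).
[cite: DupuyHilado2020, §7.1 p.22 l.44–53] -/
theorem E2_of_j (p : ℕ) [Fact p.Prime] (lstar : ℕ) (g : ℕ → ℝ) :
    E2 (F₀ := F₀) p lstar (fun j _ => g j) = (1 / (lstar : ℝ)) * ∑ i : Fin lstar, g ((i : ℕ) + 1) := by
  unfold E2
  congr 1
  refine Finset.sum_congr rfl fun i _ => ?_
  rw [← Finset.mul_sum, sum_tuple_weight (F₀ := F₀), mul_one]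

/-! ## §1 Jensen's inequality in the two forms used (§7.2 (7.1)), via the weighted AM–GM inequality -/

/-- Jensen for `exp_b` ((7.1) p.22 l.61, "`E(X) ≤ ln(E(exp(X)))`", base `b`): `E(a) ≤ log_b E(b^a)` for weights of
total mass one and `b > 1` — from the weighted AM–GM inequality. [cite: DupuyHilado2020, (7.1) p.22 l.54–61] -/
theorem jensen_logb {ι : Type*} (s : Finset ι) (w a : ι → ℝ) (hw : ∀ i ∈ s, 0 ≤ w i)
    (hw1 : ∑ i ∈ s, w i = 1) {b : ℝ} (hb : 1 < b) :
    ∑ i ∈ s, a i * w i ≤ Real.logb b (∑ i ∈ s, b ^ a i * w i) := by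
  have hb0 : 0 < b := by linarith
  have key := Real.geom_mean_le_arith_mean_weighted s w (fun i => b ^ a i) hw hw1
    (fun i _ => (Real.rpow_pos_of_pos hb0 _).le)
  have hprod : ∏ i ∈ s, (b ^ a i) ^ w i = b ^ (∑ i ∈ s, a i * w i) := by
    rw [Real.rpow_sum_of_pos hb0]
    refine Finset.prod_congr rfl fun i _ => ?_
    rw [← Real.rpow_mul hb0.le]
  rw [hprod] at key
  calc ∑ i ∈ s, a i * w i = Real.logb b (b ^ ∑ i ∈ s, a i * w i) := by
        rw [Real.logb_rpow hb0 hb.ne']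
    _ ≤ Real.logb b (∑ i ∈ s, w i * b ^ a i) :=
        Real.logb_le_logb_of_le hb (Real.rpow_pos_of_pos hb0 _) key
    _ = Real.logb b (∑ i ∈ s, b ^ a i * w i) := by
        congr 1; exact Finset.sum_congr rfl fun i _ => mul_comm _ _

/-- Jensen for `ln` ((7.1) p.22 l.61, "`exp(E(ln(X))) ≤ E(X)`"): `E(ln z) ≤ ln E(z)` for weights of total mass
one and `z > 0`. [cite: DupuyHilado2020, (7.1) p.22 l.54–61] -/
theorem jensen_log {ι : Type*} (s : Finset ι) (w z : ι → ℝ) (hw : ∀ i ∈ s, 0 ≤ w i)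
    (hw1 : ∑ i ∈ s, w i = 1) (hz : ∀ i ∈ s, 0 < z i) :
    ∑ i ∈ s, Real.log (z i) * w i ≤ Real.log (∑ i ∈ s, z i * w i) := by
  have key := Real.geom_mean_le_arith_mean_weighted s w z hw hw1 (fun i hi => (hz i hi).le)
  have hpos : 0 < ∏ i ∈ s, z i ^ w i := Finset.prod_pos fun i hi => Real.rpow_pos_of_pos (hz i hi) _
  calc ∑ i ∈ s, Real.log (z i) * w i = Real.log (∏ i ∈ s, z i ^ w i) := by
        rw [Real.log_prod fun i hi => (Real.rpow_pos_of_pos (hz i hi) _).ne']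
        refine Finset.sum_congr rfl fun i hi => ?_
        rw [Real.log_rpow (hz i hi), mul_comm]
    _ ≤ Real.log (∑ i ∈ s, w i * z i) := Real.log_le_log hpos key
    _ = Real.log (∑ i ∈ s, z i * w i) := by
        congr 1; exact Finset.sum_congr rfl fun i _ => mul_comm _ _


/-! ## Plumbing: averages over the procession index `j = 1,…,ℓ⋆`, and the constants -/

/-- `Σ_{i<n} (i+1) = n(n+1)/2` over `ℝ` — the display "`(2/(l−1)) Σ_{j=1}^{(l−1)/2} j·diff_p = ((l+1)/4)·diff_p`"
(p.26 l.5–15) with `n = ℓ⋆ = (l−1)/2`. [cite: DupuyHilado2020, §7.7 p.26 l.5–15] -/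
theorem sum_fin_add_one (n : ℕ) : ∑ i : Fin n, (((i : ℕ) : ℝ) + 1) = n * (n + 1) / 2 := by
  have key : ∀ m : ℕ, ∑ i ∈ Finset.range m, (((i : ℕ) : ℝ) + 1) = m * (m + 1) / 2 := by
    intro m
    induction m with
    | zero => simp
    | succ m ih => rw [Finset.sum_range_succ, ih]; push_cast; ring
  rw [Fin.sum_univ_eq_sum_range (fun i => ((i : ℝ) + 1)) n, key]

/-- `Σ_{i<n} (i+2) = n(n+3)/2` over `ℝ` — the display "`(2/(l−1)) Σ_{j=1}^{(l−1)/2} (j+1) ln(π) = ((l+5)/4) ln(π)`"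
(§7.11 p.27 l.24–30) with `n = ℓ⋆`. [cite: DupuyHilado2020, §7.11 p.27 l.24–30] -/
theorem sum_fin_add_two (n : ℕ) : ∑ i : Fin n, (((i : ℕ) : ℝ) + 1 + 1) = n * (n + 3) / 2 := by
  have key : ∀ m : ℕ, ∑ i ∈ Finset.range m, (((i : ℕ) : ℝ) + 1 + 1) = m * (m + 3) / 2 := by
    intro m
    induction m with
    | zero => simp
    | succ m ih => rw [Finset.sum_range_succ, ih]; push_cast; ring
  rw [Fin.sum_univ_eq_sum_range (fun i => ((i : ℝ) + 1 + 1)) n, key]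

/-- The tuple-average of a sum over the coordinates is `(j+1)` times the place-average (prime `p`) — the
linearity-plus-marginals step of Lemma 7.7.1 (2) and of §7.10. [cite: DupuyHilado2020, §7.3 p.23 l.1–8] -/
theorem sum_tuple_sum_coord (p : ℕ) [Fact p.Prime] (j : ℕ) (g : HeightOneSpectrum (𝓞 F₀) → ℝ) :
    ∑ e : Fin (j + 1) → placesOver F₀ p, (∑ i, g (e i).1) * ∏ k, weight F₀ (e k).1 =
      ((j : ℝ) + 1) * ∑ v ∈ placesOver F₀ p, g v * weight F₀ v := by
  calc ∑ e : Fin (j + 1) → placesOver F₀ p, (∑ i, g (e i).1) * ∏ k, weight F₀ (e k).1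
      = ∑ i : Fin (j + 1), ∑ e : Fin (j + 1) → placesOver F₀ p, g (e i).1 * ∏ k, weight F₀ (e k).1 := by
        rw [Finset.sum_comm]
        exact Finset.sum_congr rfl fun e _ => Finset.sum_mul _ _ _
    _ = ∑ _i : Fin (j + 1), ∑ v ∈ placesOver F₀ p, g v * weight F₀ v :=
        Finset.sum_congr rfl fun i _ => sum_tuple_coord' p j i g
    _ = ((j : ℝ) + 1) * ∑ v ∈ placesOver F₀ p, g v * weight F₀ v := by
        rw [Finset.sum_const, Finset.card_univ, Fintype.card_fin, nsmul_eq_mul]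
        push_cast
        ring

/-- `0 ≤ P_{unr,p}`. [cite: DupuyHilado2020, Def. 1.0.2 (1.2) p.3 l.4–8] -/
theorem probUnram_nonneg (p : ℕ) : 0 ≤ R.probUnram p :=
  Finset.sum_nonneg fun v _ => weight_nonneg F₀ v

/-- `P_{unr,p} ≤ 1` (prime `p`). [cite: DupuyHilado2020, Def. 1.0.2 (1.2) p.3 l.4–8] -/
theorem probUnram_le_one (p : ℕ) [Fact p.Prime] : R.probUnram p ≤ 1 := by
  unfold SectionRamification.probUnram
  calc ∑ v ∈ (placesOver F₀ p).filter (fun v => R.e v = 1), weight F₀ v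
      ≤ ∑ v ∈ placesOver F₀ p, weight F₀ v :=
        Finset.sum_le_sum_of_subset_of_nonneg (Finset.filter_subset _ _) fun v _ _ => weight_nonneg F₀ v
    _ = 1 := sum_weight p

/-- `ln(b_p) < 0` for every prime `p`: `b_p = 1/(exp(1) ln p) < 1` since `exp(1)·ln 2 > 1.88`. This sign is
what the printed step (7.12) overlooks (see `DHProbabilisticSzpiroTermIV`). [cite: DupuyHilado2020, Thm 1.0.3 p.3 l.35] -/
theorem log_bConst_neg (p : ℕ) (hp : p.Prime) : Real.log (bConst p) < 0 := by
  unfold bConst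
  have h2 : (2 : ℝ) ≤ p := by exact_mod_cast hp.two_le
  have hlog : Real.log 2 ≤ Real.log p := Real.log_le_log two_pos h2
  have he : 2.7182818283 < Real.exp 1 := Real.exp_one_gt_d9
  have hl2 : 0.6931471803 < Real.log 2 := Real.log_two_gt_d9
  have hprod : 1 < Real.exp 1 * Real.log p := by nlinarith [Real.exp_pos 1]
  rw [one_div, Real.log_inv]
  have : 0 < Real.log (Real.exp 1 * Real.log p) := Real.log_pos hprod
  linarith

/-! ## §2 Lemma 7.7.1 (2) and (7.8): the bound on `II_p` -/

/-- Jensen step of Lemma 7.7.1 (2): `E(diff(v/p)) ≤ diff_p = log_p E(p^{diff(v/p)})` (prime `p`).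
[cite: DupuyHilado2020, Lemma 7.7.1 (2) p.25 l.47–51] -/
theorem expect_diff_le_avgDiffExp (p : ℕ) [hp : Fact p.Prime] :
    ∑ v ∈ placesOver F₀ p, R.diff v * weight F₀ v ≤ R.avgDiffExp p := by
  have hb : (1 : ℝ) < p := by exact_mod_cast hp.out.one_lt
  exact jensen_logb _ (weight F₀) R.diff (fun v _ => weight_nonneg F₀ v) (sum_weight p) hb

/-- **Lemma 7.7.1 (2)** PROVED for prime `p`: `E(‖diff_{(v_0,…,v_j)}‖₁) ≤ (j+1)·diff_p` (the typed candidate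
`SectionRamification.Lemma771ii`, discharged). [cite: DupuyHilado2020, Lemma 7.7.1 (2) p.25 l.20, l.47–51] -/
theorem lemma771ii_holds (p : ℕ) [Fact p.Prime] (j : ℕ) : R.Lemma771ii p j := by
  unfold SectionRamification.Lemma771ii
  rw [sum_tuple_sum_coord p j R.diff]
  exact mul_le_mul_of_nonneg_left (expect_diff_le_avgDiffExp R p) (by positivity)

/-- The `j`-th inner average of `II_p` is at most `j·diff_p·ln p` (p.25 l.54–58: Lemma 7.7.1 (1) then (2)).
[cite: DupuyHilado2020, §7.7 p.25 l.53–58] -/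
theorem sum_tuple_ordβ_le (p : ℕ) [hp : Fact p.Prime] (j : ℕ) :
    ∑ e : Fin (j + 1) → placesOver F₀ p, R.ordβ e * Real.log p * ∏ k, weight F₀ (e k).1 ≤
      (j : ℝ) * (R.avgDiffExp p * Real.log p) := by
  have hlog : 0 ≤ Real.log p := Real.log_natCast_nonneg p
  calc ∑ e : Fin (j + 1) → placesOver F₀ p, R.ordβ e * Real.log p * ∏ k, weight F₀ (e k).1
      ≤ ∑ e : Fin (j + 1) → placesOver F₀ p,
          (((j : ℝ) / (j + 1)) * ∑ i, R.diff (e i).1) * Real.log p * ∏ k, weight F₀ (e k).1 := by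
        refine Finset.sum_le_sum fun e _ => ?_
        have h1 : R.ordβ e ≤ ((j : ℝ) / (j + 1)) * ∑ i, R.diff (e i).1 :=
          norm_one_sub_norm_infty_le (fun i => R.diff (e i).1) fun i => R.diff_nonneg _
        exact mul_le_mul_of_nonneg_right (mul_le_mul_of_nonneg_right h1 hlog)
          (Finset.prod_nonneg fun k _ => weight_nonneg F₀ _)
    _ = ((j : ℝ) / (j + 1)) * Real.log p *
          ∑ e : Fin (j + 1) → placesOver F₀ p, (∑ i, R.diff (e i).1) * ∏ k, weight F₀ (e k).1 := by
        rw [Finset.mul_sum]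
        exact Finset.sum_congr rfl fun e _ => by ring
    _ = (j : ℝ) * Real.log p * ∑ v ∈ placesOver F₀ p, R.diff v * weight F₀ v := by
        rw [sum_tuple_sum_coord p j R.diff]
        field_simp
    _ ≤ (j : ℝ) * Real.log p * R.avgDiffExp p :=
        mul_le_mul_of_nonneg_left (expect_diff_le_avgDiffExp R p) (by positivity)
    _ = (j : ℝ) * (R.avgDiffExp p * Real.log p) := by ring

/-- **(7.8)** PROVED for prime `p`: `II_p ≤ ((l+1)/4)·diff_p·ln(p)` (the typed candidate `BoundII`, discharged;
"It remains to compute the expectation of these over `{1,…,j}`", p.26 l.3–16). [cite: DupuyHilado2020, (7.8) p.25 l.4–6; p.26 l.1–16] -/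
theorem boundII_holds (p : ℕ) [Fact p.Prime] : BoundII X R p := by
  have hl : (X.lstar : ℝ) ≠ 0 := by
    have := X.two_le_lstar
    exact_mod_cast (by omega : X.lstar ≠ 0)
  unfold BoundII termII E2
  calc (1 / (X.lstar : ℝ)) * ∑ i : Fin X.lstar, ∑ e : Fin ((i : ℕ) + 1 + 1) → placesOver F₀ p,
          R.ordβ e * Real.log p * ∏ k, weight F₀ (e k).1
      ≤ (1 / (X.lstar : ℝ)) * ∑ i : Fin X.lstar, (((i : ℕ) + 1 : ℕ) : ℝ) * (R.avgDiffExp p * Real.log p) :=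
        mul_le_mul_of_nonneg_left (Finset.sum_le_sum fun i _ => sum_tuple_ordβ_le R p ((i : ℕ) + 1))
          (by positivity)
    _ = (((2 * (X.lstar : ℝ) + 1) + 1) / 4) * R.avgDiffExp p * Real.log p := by
        rw [← Finset.sum_mul]
        push_cast
        rw [sum_fin_add_one]
        field_simp
        ring

/-! ## §3 (7.10)–(7.11): the exact value of `III_p` and its bound -/

/-- `P_{unr,p}` as the place-average of the indicator of "unramified" ((7.10) p.26 l.17–20).
[cite: DupuyHilado2020, (7.10) p.26 l.17–20] -/
theorem probUnram_eq_sum_ite (p : ℕ) :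
    R.probUnram p = ∑ v : placesOver F₀ p, (if R.e v.1 = 1 then (1 : ℝ) else 0) * weight F₀ v.1 := by
  unfold SectionRamification.probUnram
  rw [Finset.sum_filter,
    ← Finset.sum_coe_sort (placesOver F₀ p) (fun v => if R.e v = 1 then weight F₀ v else 0)]
  refine Finset.sum_congr rfl fun v _ => ?_
  split_ifs <;> simp

/-- "`E(1_ram(v_0,…,v_j)) = 1 − P_{unr,p}^{j+1}`" (p.26 l.21–24) PROVED for prime `p` (independence of the
coordinates). [cite: DupuyHilado2020, §7.8 p.26 l.21–24] -/
theorem sum_tuple_indRam (p : ℕ) [Fact p.Prime] (j : ℕ) :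
    ∑ e : Fin (j + 1) → placesOver F₀ p, R.indRam e * ∏ k, weight F₀ (e k).1 =
      1 - R.probUnram p ^ (j + 1) := by
  have h : ∀ e : Fin (j + 1) → placesOver F₀ p,
      R.indRam e = 1 - ∏ i, (if R.e (e i).1 = 1 then (1 : ℝ) else 0) := by
    intro e
    by_cases hu : R.IsUnramifiedTuple e
    · simp only [SectionRamification.indRam, if_pos hu]
      rw [Finset.prod_eq_one fun i _ => if_pos (hu i)]
      ring
    · simp only [SectionRamification.indRam, if_neg hu]
      obtain ⟨i, hi⟩ := not_forall.mp hu
      rw [Finset.prod_eq_zero (Finset.mem_univ i) (if_neg hi)]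
      ring
  have h2 : ∑ e : Fin (j + 1) → placesOver F₀ p,
      (∏ i, (if R.e (e i).1 = 1 then (1 : ℝ) else 0)) * ∏ k, weight F₀ (e k).1 =
        R.probUnram p ^ (j + 1) := by
    rw [sum_tuple_prod p (j + 1) (fun v => if R.e v.1 = 1 then (1 : ℝ) else 0),
      ← probUnram_eq_sum_ite]
  calc ∑ e : Fin (j + 1) → placesOver F₀ p, R.indRam e * ∏ k, weight F₀ (e k).1
      = ∑ e : Fin (j + 1) → placesOver F₀ p, (∏ k, weight F₀ (e k).1 -
          (∏ i, (if R.e (e i).1 = 1 then (1 : ℝ) else 0)) * ∏ k, weight F₀ (e k).1) :=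
        Finset.sum_congr rfl fun e _ => by rw [h e]; ring
    _ = 1 - R.probUnram p ^ (j + 1) := by
        rw [Finset.sum_sub_distrib, sum_tuple_weight (F₀ := F₀), h2]

/-- **(7.11), exact form** PROVED for prime `p`: `III_p = 1 − (2/(l−1)) Σ_{j=1}^{(l−1)/2} P_{unr,p}^{j+1}`
(p.26 l.25–40; index `i : Fin ℓ⋆` is `j = i+1`). [cite: DupuyHilado2020, §7.8 p.26 l.25–40] -/
theorem termIII_eq (p : ℕ) [Fact p.Prime] :
    termIII X R p = (1 / (X.lstar : ℝ)) * ∑ i : Fin X.lstar, (1 - R.probUnram p ^ ((i : ℕ) + 1 + 1)) := by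
  unfold termIII E2
  congr 1
  exact Finset.sum_congr rfl fun i _ => sum_tuple_indRam R p ((i : ℕ) + 1)

/-- **(7.11)** PROVED for prime `p`: `III_p ≤ 1 − P_{unr,p}^{(l+1)/2}` ("the smallest of the `P^{j+1}` is
`P^{(l+1)/2}`", p.26 l.41–45; the typed candidate `BoundIII`, discharged). [cite: DupuyHilado2020, (7.11) p.26 l.41–45] -/
theorem boundIII_holds (p : ℕ) [Fact p.Prime] : BoundIII X R p := by
  have hl2 := X.two_le_lstar
  have hl : (X.lstar : ℝ) ≠ 0 := by exact_mod_cast (by omega : X.lstar ≠ 0)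
  have hP0 := probUnram_nonneg R p
  have hP1 := probUnram_le_one R p
  unfold BoundIII
  rw [termIII_eq]
  have hterm : ∀ i : Fin X.lstar,
      1 - R.probUnram p ^ ((i : ℕ) + 1 + 1) ≤ 1 - R.probUnram p ^ (X.lstar + 1) := by
    intro i
    have hi := i.2
    have : R.probUnram p ^ (X.lstar + 1) ≤ R.probUnram p ^ ((i : ℕ) + 1 + 1) :=
      pow_le_pow_of_le_one hP0 hP1 (by omega)
    linarith
  calc (1 / (X.lstar : ℝ)) * ∑ i : Fin X.lstar, (1 - R.probUnram p ^ ((i : ℕ) + 1 + 1))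
      ≤ (1 / (X.lstar : ℝ)) * ∑ _i : Fin X.lstar, (1 - R.probUnram p ^ (X.lstar + 1)) :=
        mul_le_mul_of_nonneg_left (Finset.sum_le_sum fun i _ => hterm i) (by positivity)
    _ = 1 - R.probUnram p ^ (X.lstar + 1) := by
        rw [Finset.sum_const, Finset.card_univ, Fintype.card_fin, nsmul_eq_mul]
        field_simp


end ExplicitSzpiro

end Literature.IUT.LogVolume

end
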